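import Summits.BirchSwinnertonDyer.BirchSwinnertonDyer.Theorems.GenusKolyvaginAtTwoGenusPrimitiveSupplyAtTwoOfKernels
import Summits.BirchSwinnertonDyer.BirchSwinnertonDyer.Theorems.GenusKolyvaginAtTwoGenusPrimitiveSupplyAtTwoHabitatCutStubA
import HarnessLib

/-!
# Route `GenusKolyvaginAtTwo` — the DECIDING Δ<0 supply crux `GenusDeepSupplyAtTwoNegDiscNarrow` (stmt-BirchSwinnertonDyer-23491,
# crux rank 2, rev 40 = R8 «wide-Selmer cut») BY NAME FROM ITS OPEN KERNELS

LEAD seat `bsd-line-gk2-p1` g21 (cell `bsd-f1-sign2`), line `genus_deep_supply_narrow` (pen bsd-idea-1 g22 v4 ∕ LEAD g20 registration,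
stubs A″ `stub_minimalTwinSupplyAtTwoNarrow` ∕ B `stub_heegnerNonTorsionAtTwo` ∕ C `stub_genusPrimitivityAtTwo`), `--supports
stmt-BirchSwinnertonDyer-23491`.  THEOREMS ONLY (no definition, no named fact, no `sorry`); CONDITIONAL on its displayed binders.
**BSD is NOT proved by this file; the crux is NOT closed by it** — it is REDUCED, kernel-checked, to
* the Gross–Zagier formula (route support `GrossZagierAllLevels`, stmt-24148, PRINT: discharges stub B through gk2-p4's
  `GenusKoly.stub_heegnerNonTorsionAtTwo_pair_of_grossZagier`),
* stub A″ VERBATIM (registered signature: the narrow-Selmer minimal-twin supply, `ord₂ c(Wd) ≤ 1`), and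
* stub C in its RESHAPED form C‴ = «DEEP `2`-PRIMITIVITY AT POSITIVE DEPTH»: the registered C with the crux's own binders `W.Δ < 0`,
  the narrow-Selmer hypothesis, McCallum's exponent `M₀` WITH ITS TWO DIVISIBILITY CLAUSES and `1 ≤ M₀` threaded in, and the
  Tamagawa guard tightened to A″'s output `≤ 1` — because the depth-zero case `M₀ = 0` is CLOSED here (§1: the conductor-`1`
  datum itself is the witness, `n = 1`, the deep-prime clause is vacuous), so the open stub is exactly Kolyvagin's conjecture at
  `p = 2` in the deep currency for `2`-DIVISIBLE `y_K`.
§3 re-derives the registered (un-reshaped) C ⟹ C‴, so nothing already aimed at C is lost.  §4 discharges stub A″ from ROUTE ITEMS (gk2-p5 g20's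
`GenusKolyTwistingPrime.stub_minimalTwinSupplyAtTwo_genusBudget_one_of_twoConverse`: Modularity `ModularityExistsNewform` + the `2`-parity theorem
`TwoParityDD` + the rank-one `2`-converse `RankOneTwoConverse` ∧ `RankOneTwoConverseOffSemistableAtTwo`), so that THE DECIDING CRUX IS, BY NAME,
«five route items (three PRINT, two the declared `2`-converse residual) + ONE beyond-print stub C‴» (`genusDeepSupplyAtTwoNegDiscNarrow_of_items_of_stubC`).

References: [GrossLMS1991] §3 (3.3)–(3.5), §4 (4.1); [McCallumLMS1991] §5 Lemma 5.1; [GrossZagier1986] Thm. I.6.3 with V.§2;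
[WZhang2014] Thm. 1.1 (the `p ≥ 5` analogue of C‴); [Kolyvagin1991MathAnn] Conj. A.
-/

set_option autoImplicit false
set_option linter.dupNamespace false -- `Summit.<P>.<Sub>` repeats `BirchSwinnertonDyer` (D-0017)

noncomputable section

open scoped Classical

namespace Summit.BirchSwinnertonDyer.BirchSwinnertonDyer.Theorems.GenusSupplyNarrow

open WeierstrassCurve Literature.NumberTheory.EllipticCurves Literature.NumberTheory.EllipticCurves.ModularForms
  Summit.BirchSwinnertonDyer.BirchSwinnertonDyer.Theses.GenusKolyvaginAtTwo
  Summit.BirchSwinnertonDyer.BirchSwinnertonDyer.Theorems.GenusKoly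

/-! ## §1 Depth zero is free -/

/-- **Depth zero is free.** If `y_K = P(1)` is NOT `2`-divisible in `E(K[1])` (`M₀ = 0` in McCallum's normalisation), the
conductor-`1` datum is already a witness of the crux's deep clause: `n = 1` is square-free, has no prime factors (so every
«deep Kolyvagin prime» condition on `ℓ ∣ n` holds vacuously), and `P(1) ∉ 2E(K[1])`.  Pure bookkeeping.
[cite: GrossLMS1991, §4 (4.1) (P(1) = y_K)] -/
theorem exists_deepWitness_of_depth_zero (W : WeierstrassCurve ℚ) {K : Type} [Field K] [NumberField K]
    {N : ℕ} [NeZero N] (Dt : ModularParametrizationData W N) (β : ℤ) (ι : K →+* ℂ)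
    (d₁ : KolyvaginHeegnerData Dt β ι 1) (P : ℕ → Prop)
    (hndiv : ¬ ∃ Q : (W.baseChange (ringClassField K ι 1)).toAffine.Point, ((2 ^ (0 + 1) : ℕ) : ℤ) • Q = d₁.derivedPoint) :
    ∃ (n : ℕ) (d : KolyvaginHeegnerData Dt β ι n), Squarefree n ∧ (∀ ℓ ∈ n.primeFactors, P ℓ) ∧
      ¬ ∃ Q : (W.baseChange (ringClassField K ι n)).toAffine.Point, (2 : ℤ) • Q = d.derivedPoint := by
  refine ⟨1, d₁, squarefree_one, fun ℓ hℓ ↦ ?_, ?_⟩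
  · simp [Nat.primeFactors_one] at hℓ
  · simpa using hndiv

/-! ## §2 The crux by name from GZ ∧ A″ ∧ C‴ -/

/-- **THE DECIDING Δ<0 CRUX `GenusDeepSupplyAtTwoNegDiscNarrow` (stmt-BirchSwinnertonDyer-23491) BY NAME FROM ITS OPEN KERNELS.**
Hypotheses: `hGZ` = the route support `GrossZagierAllLevels` (PRINT; the binder `closes` already holds); `hA` = the registered stub
A″ `stub_minimalTwinSupplyAtTwoNarrow` VERBATIM; `hC` = stub C RESHAPED to C‴ (takes `W.Δ < 0`, the narrow-Selmer hypothesis,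
`M₀` with McCallum's two divisibility clauses, `1 ≤ M₀`, and the guard `ord₂ c(Wd) ≤ 1`).  Composition: A″ gives `K` and the twin;
the habitat gives the odd-Manin datum; orientation `β` (Gross 1984 §3), embedding `ι`, conductor-`1` datum `d₁` (Darmon Thm. 3.6,
PROVED) exist; the twin is non-CM (`twin_not_hasCM`) and `r_an(E^{(d_K)}) = r_an(Wd) = 1` (`analyticRank_smul`); B from `hGZ` at the
pair (gk2-p4 `stub_heegnerNonTorsionAtTwo_pair_of_grossZagier`); `M₀` exists (`exists_exactTwoDivisibility_of_not_isOfFinAddOrder`);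
at `M₀ = 0` the witness is `n = 1` (§1), at `M₀ ≥ 1` it is C‴.  CONDITIONAL; the crux is OPEN exactly at A″ ∧ C‴.  BSD is NOT proved
by this. [cite: GrossZagier1986, Thm. I.6.3 with V.§2] [cite: GrossLMS1991, §3 (3.5), §4 (4.1)] [cite: McCallumLMS1991, §5 Lemma 5.1] -/
theorem genusDeepSupplyAtTwoNegDiscNarrow_of_kernels (hGZ : GrossZagierAllLevels)
    (hA : ∀ (W : WeierstrassCurve ℚ) [W.IsElliptic] [W.IsGloballyMinimal] [NeZero (W.conductorNorm ℤ)],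
      ¬ W.HasCM → W.analyticRank = 0 → (∀ n : ℕ, 0 < n → W.HasSurjectiveModNGaloisRep ((2 : ℤ) ^ n)) →
      Odd W.tamagawaProduct → W.Δ < 0 → (Nat.card (W.selmerGroup 2) = 1 ∨ Nat.card (W.selmerGroup 2) = 4) →
      ∃ (K : Type) (_ : Field K) (_ : NumberField K),
        IsImaginaryQuadratic K ∧ Odd (NumberField.discr K) ∧ NumberField.discr K ≠ -3 ∧
        SatisfiesHeegnerHypothesis (W.conductorNorm ℤ) K ∧
        ¬ IsSquare ((NumberField.discr K : ℚ) * -|W.Δ|) ∧ ¬ IsSquare ((NumberField.discr K : ℚ) * (-(2 * |W.Δ|))) ∧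
        ∃ (Wd : WeierstrassCurve ℚ) (_ : Wd.IsElliptic) (_ : Wd.IsGloballyMinimal),
          (∃ C : WeierstrassCurve.VariableChange ℚ, C • W.quadraticTwist (NumberField.discr K : ℚ) = Wd) ∧
          Wd.analyticRank = 1 ∧ Nat.card (Wd.selmerGroup 2) = 2 ∧ padicValNat 2 Wd.tamagawaProduct ≤ 1)
    (hC : ∀ (W : WeierstrassCurve ℚ) [W.IsElliptic] [W.IsGloballyMinimal] [NeZero (W.conductorNorm ℤ)],
      ¬ W.HasCM → W.analyticRank = 0 → (∀ n : ℕ, 0 < n → W.HasSurjectiveModNGaloisRep ((2 : ℤ) ^ n)) →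
      Odd W.tamagawaProduct → W.Δ < 0 → (Nat.card (W.selmerGroup 2) = 1 ∨ Nat.card (W.selmerGroup 2) = 4) →
      ∀ (K : Type) [Field K] [NumberField K],
      IsImaginaryQuadratic K → Odd (NumberField.discr K) → NumberField.discr K ≠ -3 →
      SatisfiesHeegnerHypothesis (W.conductorNorm ℤ) K →
      ¬ IsSquare ((NumberField.discr K : ℚ) * -|W.Δ|) → ¬ IsSquare ((NumberField.discr K : ℚ) * (-(2 * |W.Δ|))) →
      ∀ (Dt : ModularParametrizationData W (W.conductorNorm ℤ)),
      (∀ z ∈ Dt.L.lattice, ∃ w ∈ periodLattice Dt.f, z = (Dt.c : ℂ) * w) → Odd Dt.c →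
      ∀ (β : ℤ) (ι : K →+* ℂ) (d₁ : KolyvaginHeegnerData Dt β ι 1), ¬ IsOfFinAddOrder d₁.derivedPoint →
      ∀ (M₀ : ℕ), (∃ Q : (W.baseChange (ringClassField K ι 1)).toAffine.Point, ((2 ^ M₀ : ℕ) : ℤ) • Q = d₁.derivedPoint) →
      (¬ ∃ Q : (W.baseChange (ringClassField K ι 1)).toAffine.Point, ((2 ^ (M₀ + 1) : ℕ) : ℤ) • Q = d₁.derivedPoint) →
      1 ≤ M₀ →
      ∀ (Wd : WeierstrassCurve ℚ) [Wd.IsElliptic] [Wd.IsGloballyMinimal],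
      (∃ C : WeierstrassCurve.VariableChange ℚ, C • W.quadraticTwist (NumberField.discr K : ℚ) = Wd) →
      Wd.analyticRank = 1 → Nat.card (Wd.selmerGroup 2) = 2 → padicValNat 2 Wd.tamagawaProduct ≤ 1 →
      ∃ (n : ℕ) (d : KolyvaginHeegnerData Dt β ι n), Squarefree n ∧
        (∀ ℓ ∈ n.primeFactors, Zhang2014.IsKolyvaginPrime (W.conductorNorm ℤ) W K 2 ℓ ∧ 2 ≤ Zhang2014.kolyvaginIndex W 2 ℓ ∧
          FrobEqFrobInfty W K 2 ℓ) ∧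
        ¬ ∃ Q : (W.baseChange (ringClassField K ι n)).toAffine.Point, (2 : ℤ) • Q = d.derivedPoint) :
    GenusDeepSupplyAtTwoNegDiscNarrow := by
  intro W _ _ _ hcm hr0 hρ hT hneg hopt h14
  -- A″: the field and the narrow twin
  obtain ⟨K, iF, iN, hIQ, hodd, h3, hHe, hsq1, hsq2, Wd, iE, iM, hWd, hrd, hSel, hDEF⟩ := hA W hcm hr0 hρ hT hneg h14
  obtain ⟨Dt, hoptDt, hc⟩ := hopt
  -- glue: orientation, embedding, conductor-`1` datum
  obtain ⟨β, hβ⟩ : ∃ β : ℤ, (4 * (W.conductorNorm ℤ : ℕ) : ℤ) ∣ β ^ 2 - NumberField.discr K :=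
    Literature.NumberTheory.QuadraticFields.Quadratic.exists_dvd_sq_sub_discr_of_ncard_primesOver hIQ.1 (NeZero.ne _) hHe
  obtain ⟨ι⟩ : Nonempty (K →+* ℂ) := inferInstance
  obtain ⟨d₁⟩ := exists_kolyvaginHeegnerData_one
    (phi_heegnerTau_mem_singularModuliField_holds (W.conductorNorm ℤ) W K) hIQ Dt β ι hβ
  -- the twin: non-CM; the analytic rank of the twist is read off its minimal model
  have hd : (NumberField.discr K : ℚ) ≠ 0 := by exact_mod_cast NumberField.discr_ne_zero K
  haveI := W.isElliptic_quadraticTwist hd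
  have hcmd : ¬ Wd.HasCM := twin_not_hasCM W hcm hd Wd hWd
  have hrtw : (W.quadraticTwist (NumberField.discr K : ℚ)).analyticRank = 1 := by
    obtain ⟨C, hC⟩ := hWd
    rw [← analyticRank_smul (W.quadraticTwist (NumberField.discr K : ℚ)) C, hC]
    exact hrd
  -- B from Gross–Zagier at the pair `(E, K)`, level `N_E`
  have hy : ¬ IsOfFinAddOrder d₁.derivedPoint :=
    stub_heegnerNonTorsionAtTwo_pair_of_grossZagier W K (hGZ (W.conductorNorm ℤ) W K) hIQ hHe hr0 hrtw Dt β ι d₁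
  -- McCallum's exponent
  obtain ⟨M₀, hdiv, hndiv⟩ := exists_exactTwoDivisibility_of_not_isOfFinAddOrder W hIQ Dt β ι d₁ hy
  -- the deep witness: free at depth `0`, C‴ at positive depth
  obtain ⟨n, d, hn, hKoly, hPn⟩ : ∃ (n : ℕ) (d : KolyvaginHeegnerData Dt β ι n), Squarefree n ∧
      (∀ ℓ ∈ n.primeFactors, Zhang2014.IsKolyvaginPrime (W.conductorNorm ℤ) W K 2 ℓ ∧ 2 ≤ Zhang2014.kolyvaginIndex W 2 ℓ ∧
        FrobEqFrobInfty W K 2 ℓ) ∧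
      ¬ ∃ Q : (W.baseChange (ringClassField K ι n)).toAffine.Point, (2 : ℤ) • Q = d.derivedPoint := by
    rcases Nat.eq_zero_or_pos M₀ with hM | hM
    · subst hM
      exact exists_deepWitness_of_depth_zero W Dt β ι d₁ _ hndiv
    · exact hC W hcm hr0 hρ hT hneg h14 K hIQ hodd h3 hHe hsq1 hsq2 Dt hoptDt hc β ι d₁ hy M₀ hdiv hndiv hM
        Wd hWd hrd hSel hDEF
  exact ⟨K, iF, iN, hIQ, hodd, h3, hHe, hsq1, hsq2, Dt, β, ι, d₁, hoptDt, hc, hy, M₀, hdiv, hndiv, n, d, hn, hKoly, hPn,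
    Wd, iE, iM, hWd, hcmd, hrd, hSel, hDEF⟩

/-! ## §3 The registered stub C implies its reshaped form C‴ -/

/-- **Registered C ⟹ reshaped C‴**: the un-reshaped registered signature of `stub_genusPrimitivityAtTwo` (no `Δ < 0`, no Selmer
hypothesis, no `M₀`, guard `≤ 2`) implies C‴ by weakening — so every closer written against the registered C still feeds §2.
Pure logic. [cite: GrossLMS1991, §3 (3.5)] -/
theorem stubC_reshaped_of_registered
    (hC : ∀ (W : WeierstrassCurve ℚ) [W.IsElliptic] [W.IsGloballyMinimal] [NeZero (W.conductorNorm ℤ)],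
      ¬ W.HasCM → W.analyticRank = 0 → (∀ n : ℕ, 0 < n → W.HasSurjectiveModNGaloisRep ((2 : ℤ) ^ n)) →
      Odd W.tamagawaProduct →
      ∀ (K : Type) [Field K] [NumberField K],
      IsImaginaryQuadratic K → Odd (NumberField.discr K) → NumberField.discr K ≠ -3 →
      SatisfiesHeegnerHypothesis (W.conductorNorm ℤ) K →
      ¬ IsSquare ((NumberField.discr K : ℚ) * -|W.Δ|) → ¬ IsSquare ((NumberField.discr K : ℚ) * (-(2 * |W.Δ|))) →
      ∀ (Dt : ModularParametrizationData W (W.conductorNorm ℤ)),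
      (∀ z ∈ Dt.L.lattice, ∃ w ∈ periodLattice Dt.f, z = (Dt.c : ℂ) * w) → Odd Dt.c →
      ∀ (β : ℤ) (ι : K →+* ℂ) (d₁ : KolyvaginHeegnerData Dt β ι 1), ¬ IsOfFinAddOrder d₁.derivedPoint →
      ∀ (Wd : WeierstrassCurve ℚ) [Wd.IsElliptic] [Wd.IsGloballyMinimal],
      (∃ C : WeierstrassCurve.VariableChange ℚ, C • W.quadraticTwist (NumberField.discr K : ℚ) = Wd) →
      Wd.analyticRank = 1 → Nat.card (Wd.selmerGroup 2) = 2 → padicValNat 2 Wd.tamagawaProduct ≤ 2 →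
      ∃ (n : ℕ) (d : KolyvaginHeegnerData Dt β ι n), Squarefree n ∧
        (∀ ℓ ∈ n.primeFactors, Zhang2014.IsKolyvaginPrime (W.conductorNorm ℤ) W K 2 ℓ ∧ 2 ≤ Zhang2014.kolyvaginIndex W 2 ℓ ∧
          FrobEqFrobInfty W K 2 ℓ) ∧
        ¬ ∃ Q : (W.baseChange (ringClassField K ι n)).toAffine.Point, (2 : ℤ) • Q = d.derivedPoint) :
    ∀ (W : WeierstrassCurve ℚ) [W.IsElliptic] [W.IsGloballyMinimal] [NeZero (W.conductorNorm ℤ)],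
      ¬ W.HasCM → W.analyticRank = 0 → (∀ n : ℕ, 0 < n → W.HasSurjectiveModNGaloisRep ((2 : ℤ) ^ n)) →
      Odd W.tamagawaProduct → W.Δ < 0 → (Nat.card (W.selmerGroup 2) = 1 ∨ Nat.card (W.selmerGroup 2) = 4) →
      ∀ (K : Type) [Field K] [NumberField K],
      IsImaginaryQuadratic K → Odd (NumberField.discr K) → NumberField.discr K ≠ -3 →
      SatisfiesHeegnerHypothesis (W.conductorNorm ℤ) K →
      ¬ IsSquare ((NumberField.discr K : ℚ) * -|W.Δ|) → ¬ IsSquare ((NumberField.discr K : ℚ) * (-(2 * |W.Δ|))) →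
      ∀ (Dt : ModularParametrizationData W (W.conductorNorm ℤ)),
      (∀ z ∈ Dt.L.lattice, ∃ w ∈ periodLattice Dt.f, z = (Dt.c : ℂ) * w) → Odd Dt.c →
      ∀ (β : ℤ) (ι : K →+* ℂ) (d₁ : KolyvaginHeegnerData Dt β ι 1), ¬ IsOfFinAddOrder d₁.derivedPoint →
      ∀ (M₀ : ℕ), (∃ Q : (W.baseChange (ringClassField K ι 1)).toAffine.Point, ((2 ^ M₀ : ℕ) : ℤ) • Q = d₁.derivedPoint) →
      (¬ ∃ Q : (W.baseChange (ringClassField K ι 1)).toAffine.Point, ((2 ^ (M₀ + 1) : ℕ) : ℤ) • Q = d₁.derivedPoint) →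
      1 ≤ M₀ →
      ∀ (Wd : WeierstrassCurve ℚ) [Wd.IsElliptic] [Wd.IsGloballyMinimal],
      (∃ C : WeierstrassCurve.VariableChange ℚ, C • W.quadraticTwist (NumberField.discr K : ℚ) = Wd) →
      Wd.analyticRank = 1 → Nat.card (Wd.selmerGroup 2) = 2 → padicValNat 2 Wd.tamagawaProduct ≤ 1 →
      ∃ (n : ℕ) (d : KolyvaginHeegnerData Dt β ι n), Squarefree n ∧
        (∀ ℓ ∈ n.primeFactors, Zhang2014.IsKolyvaginPrime (W.conductorNorm ℤ) W K 2 ℓ ∧ 2 ≤ Zhang2014.kolyvaginIndex W 2 ℓ ∧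
          FrobEqFrobInfty W K 2 ℓ) ∧
        ¬ ∃ Q : (W.baseChange (ringClassField K ι n)).toAffine.Point, (2 : ℤ) • Q = d.derivedPoint :=
  fun W _ _ _ hcm hr0 hρ hT _hneg _h14 K _ _ hIQ hodd h3 hHe hsq1 hsq2 Dt hoptDt hc β ι d₁ hy _M₀ _hdiv _hndiv _hM
      Wd _ _ hWd hrd hSel hDEF ↦
    hC W hcm hr0 hρ hT K hIQ hodd h3 hHe hsq1 hsq2 Dt hoptDt hc β ι d₁ hy Wd hWd hrd hSel (hDEF.trans one_le_two)

/-! ## §4 Stub A″ from route items; the crux by name from five route items and C‴ -/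

/-- **Stub A″ (registered signature, VERBATIM) from ROUTE ITEMS**: Modularity `ModularityExistsNewform` (stmt-19382, PRINT), the `2`-parity
theorem `TwoParityDD` (stmt-23327, PRINT) and the rank-one `2`-converse in its two declared halves `RankOneTwoConverse` (stmt-19220) ∧
`RankOneTwoConverseOffSemistableAtTwo` (stmt-24948) imply the narrow-Selmer minimal-twin supply on Δ<0 — by gk2-p5 g20's UNCONDITIONAL prime-
Heegner-field supply with genus budget one (`stub_minimalTwinSupplyAtTwo_genusBudget_one_of_twoConverse`: Mazur–Rubin Prop. 3.3 ∕ Cor. 3.4 (i)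
twisting primes `ℓ ≡ 7 (8)`, Kramer's twin Tamagawa bit, root number `−1` by Modularity, odd corank by `2`-parity, `r_an = 1` by the converse),
with `ord₂ c(Wd) = 1 ≤ 1`.  CONDITIONAL on the four items.  [cite: MazurRubin2010, Prop. 3.3, Cor. 3.4 (i)] [cite: Kramer1981, §2 Prop. 3]
[cite: DokchitserDokchitserAnnals2010, Thm. 1.4] -/
theorem stubA_narrow_of_items (hmod : ModularityExistsNewform) (hpar : TwoParityDD) (hconv : RankOneTwoConverse)
    (hconv' : RankOneTwoConverseOffSemistableAtTwo) :
    ∀ (W : WeierstrassCurve ℚ) [W.IsElliptic] [W.IsGloballyMinimal] [NeZero (W.conductorNorm ℤ)],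
      ¬ W.HasCM → W.analyticRank = 0 → (∀ n : ℕ, 0 < n → W.HasSurjectiveModNGaloisRep ((2 : ℤ) ^ n)) →
      Odd W.tamagawaProduct → W.Δ < 0 → (Nat.card (W.selmerGroup 2) = 1 ∨ Nat.card (W.selmerGroup 2) = 4) →
      ∃ (K : Type) (_ : Field K) (_ : NumberField K),
        IsImaginaryQuadratic K ∧ Odd (NumberField.discr K) ∧ NumberField.discr K ≠ -3 ∧
        SatisfiesHeegnerHypothesis (W.conductorNorm ℤ) K ∧
        ¬ IsSquare ((NumberField.discr K : ℚ) * -|W.Δ|) ∧ ¬ IsSquare ((NumberField.discr K : ℚ) * (-(2 * |W.Δ|))) ∧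
        ∃ (Wd : WeierstrassCurve ℚ) (_ : Wd.IsElliptic) (_ : Wd.IsGloballyMinimal),
          (∃ C : WeierstrassCurve.VariableChange ℚ, C • W.quadraticTwist (NumberField.discr K : ℚ) = Wd) ∧
          Wd.analyticRank = 1 ∧ Nat.card (Wd.selmerGroup 2) = 2 ∧ padicValNat 2 Wd.tamagawaProduct ≤ 1 := by
  intro W _ _ _ hcm hr0 hρ hT hneg h14
  have hc : ∀ (V : WeierstrassCurve ℚ) [V.IsElliptic] [V.IsGloballyMinimal],
      ¬ V.HasCM → V.selmerCorank 2 = 1 → V.analyticRank = 1 := fun V _ _ hV hco ↦ by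
    by_cases h : (Rank1Residual.GoodOrd V 2 ∨ Rank1Residual.Mult V 2)
    · exact hconv V hV h hco
    · exact hconv' V hV h hco
  obtain ⟨-, -, -, -, K, iF, iN, hIQ, -, hodd, h3, hHe, hsq1, hsq2, -, Wd, iE, iM, hWd, -, hrd, hSel, hB⟩ :=
    GenusKolyTwistingPrime.stub_minimalTwinSupplyAtTwo_genusBudget_one_of_twoConverse hmod hpar hc W hcm hr0 hρ hneg hT h14
  exact ⟨K, iF, iN, hIQ, hodd, h3, hHe, hsq1, hsq2, Wd, iE, iM, hWd, hrd, hSel, hB.le⟩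

/-- **THE DECIDING Δ<0 CRUX BY NAME FROM FIVE ROUTE ITEMS AND ONE BEYOND-PRINT STUB.**  `GrossZagierAllLevels` (stmt-24148, PRINT) ∧
`ModularityExistsNewform` (stmt-19382, PRINT) ∧ `TwoParityDD` (stmt-23327, PRINT) ∧ `RankOneTwoConverse` (stmt-19220, the route's declared
rank-one residual) ∧ `RankOneTwoConverseOffSemistableAtTwo` (stmt-24948, its declared complement) ∧ C‴ (deep `2`-primitivity at positive depth
on the narrow cells, the registered reshaped stub `stub_genusPrimitivityAtTwo`) ⟹ `GenusDeepSupplyAtTwoNegDiscNarrow` (stmt-23491).  So the line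
`genus_deep_supply_narrow` is OPEN at exactly ONE stub beyond the route's own items.  CONDITIONAL.  BSD is NOT proved by this.
[cite: GrossZagier1986, Thm. I.6.3 with V.§2] [cite: MazurRubin2010, Prop. 3.3, Cor. 3.4 (i)] [cite: GrossLMS1991, §3 (3.5), §4 (4.1)] -/
theorem genusDeepSupplyAtTwoNegDiscNarrow_of_items_of_stubC (hGZ : GrossZagierAllLevels) (hmod : ModularityExistsNewform)
    (hpar : TwoParityDD) (hconv : RankOneTwoConverse) (hconv' : RankOneTwoConverseOffSemistableAtTwo)
    (hC : ∀ (W : WeierstrassCurve ℚ) [W.IsElliptic] [W.IsGloballyMinimal] [NeZero (W.conductorNorm ℤ)],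
      ¬ W.HasCM → W.analyticRank = 0 → (∀ n : ℕ, 0 < n → W.HasSurjectiveModNGaloisRep ((2 : ℤ) ^ n)) →
      Odd W.tamagawaProduct → W.Δ < 0 → (Nat.card (W.selmerGroup 2) = 1 ∨ Nat.card (W.selmerGroup 2) = 4) →
      ∀ (K : Type) [Field K] [NumberField K],
      IsImaginaryQuadratic K → Odd (NumberField.discr K) → NumberField.discr K ≠ -3 →
      SatisfiesHeegnerHypothesis (W.conductorNorm ℤ) K →
      ¬ IsSquare ((NumberField.discr K : ℚ) * -|W.Δ|) → ¬ IsSquare ((NumberField.discr K : ℚ) * (-(2 * |W.Δ|))) →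
      ∀ (Dt : ModularParametrizationData W (W.conductorNorm ℤ)),
      (∀ z ∈ Dt.L.lattice, ∃ w ∈ periodLattice Dt.f, z = (Dt.c : ℂ) * w) → Odd Dt.c →
      ∀ (β : ℤ) (ι : K →+* ℂ) (d₁ : KolyvaginHeegnerData Dt β ι 1), ¬ IsOfFinAddOrder d₁.derivedPoint →
      ∀ (M₀ : ℕ), (∃ Q : (W.baseChange (ringClassField K ι 1)).toAffine.Point, ((2 ^ M₀ : ℕ) : ℤ) • Q = d₁.derivedPoint) →
      (¬ ∃ Q : (W.baseChange (ringClassField K ι 1)).toAffine.Point, ((2 ^ (M₀ + 1) : ℕ) : ℤ) • Q = d₁.derivedPoint) →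
      1 ≤ M₀ →
      ∀ (Wd : WeierstrassCurve ℚ) [Wd.IsElliptic] [Wd.IsGloballyMinimal],
      (∃ C : WeierstrassCurve.VariableChange ℚ, C • W.quadraticTwist (NumberField.discr K : ℚ) = Wd) →
      Wd.analyticRank = 1 → Nat.card (Wd.selmerGroup 2) = 2 → padicValNat 2 Wd.tamagawaProduct ≤ 1 →
      ∃ (n : ℕ) (d : KolyvaginHeegnerData Dt β ι n), Squarefree n ∧
        (∀ ℓ ∈ n.primeFactors, Zhang2014.IsKolyvaginPrime (W.conductorNorm ℤ) W K 2 ℓ ∧ 2 ≤ Zhang2014.kolyvaginIndex W 2 ℓ ∧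
          FrobEqFrobInfty W K 2 ℓ) ∧
        ¬ ∃ Q : (W.baseChange (ringClassField K ι n)).toAffine.Point, (2 : ℤ) • Q = d.derivedPoint) :
    GenusDeepSupplyAtTwoNegDiscNarrow :=
  genusDeepSupplyAtTwoNegDiscNarrow_of_kernels hGZ (stubA_narrow_of_items hmod hpar hconv hconv') hC

end Summit.BirchSwinnertonDyer.BirchSwinnertonDyer.Theorems.GenusSupplyNarrow

end
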